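import Literature.Analysis.FluidPDE.FourierL2Nonlin
import Literature.Analysis.UnboundedOperators.HeatKernel
import Mathlib.MeasureTheory.SpecificCodomains.Pi
import HarnessLib

/-!
# The Leray-regularised Navier–Stokes nonlinearity on the Fourier side: weighted `L²` bounds

First file of the Fourier-side construction of the **global regular solution of the
Leray-regularised Navier–Stokes system** `∂ₜu − νΔu + ((J u)·∇)u + ∇p = 0`, `div u = 0`,
`u(0) = J u₀`, `J = J_χ` the Friedrichs mollification by a bump kernel (Leray 1934, Ch. V §26,
(5.1); Ożański–Pooley 2018, (6.77), Thm. 6.33), i.e. of the discharge of the named fact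
`Literature.Analysis.FluidPDE.leray_regularised_wellposed` (`NSLerayRegularisedExistence`), the
last open half of Leray's existence theorem `leray_existence_R3` (the limit half is the tree's
`leray_regularised_limit_holds`).

With `u(t) = 𝓕 v(t)` (conventions of the tree's `FourierNS` files: derivatives act as `-2πiξ`,
products become the convolutions `fconv`, `J u = 𝓕 (m · v)` with the real, even, rapidly
decaying multiplier `m = 𝓕⁻¹ χ`), the regularised convective term `ℙ[((J u)·∇)u]` is the
bilinear expression `N(m • v, v)` built from the tree's projected nonlinearity `FourierNS.nonlin`.
The datum `J u₀`, `u₀ ∈ L²`, has Fourier transform `m · û₀` with `û₀ ∈ L²` merely — it lies in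
every weighted space `L²((1 + ‖ξ‖)^{2K} dξ)` but is **not** pointwise bounded, so the weighted
sup-norm (pseudo-measure) estimates of `NSFourierBilinear`/`NSFourierPicard` do not apply. This
file supplies the replacement: **weighted `L²`/`L¹` estimates** for `fconv` and `nonlin`.

* `wfun K f = (1 + ‖ξ‖)^K • f` — the weighted coefficient function; all sizes below are
  `eLpNorm (wfun K f) p volume`, `p ∈ {1, 2}` (so Minkowski/Hölder come from Mathlib).
* `weight_mul_enorm_fconv_le_eLpNorm_wfun` — **pointwise** (Cauchy–Schwarz with Peetre's inequality):
  `(1 + ‖ξ‖)^K ‖(f ⋆ g)(ξ)‖ ≤ ‖wfun K f‖_{L²} ‖wfun K g‖_{L²}`; in particular the convolution of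
  two `L²` functions is bounded at **every** frequency (`enorm_fconv_le_eLpNorm`).
* `lintegral_lintegral_mul_shift_sq_le` — **Young `L¹ × L² → L²`** for the `ℝ≥0∞`-valued convolution
  `∫⁻ k(η) F(ξ - η) dη` (Cauchy–Schwarz in `η`, Tonelli), and hence
  `eLpNorm_wfun_fconv_le`: `‖wfun K (f ⋆ g)‖_{L²} ≤ ‖wfun K f‖_{L¹} ‖wfun K g‖_{L²}`.
* the multiplier absorbs every weight (`cmul m f = m · f`, `vmul m V = m • V`):
  `‖wfun K (m f)‖_{L¹} ≤ ‖wfun K m‖_{L²} ‖f‖_{L²}` (`eLpNorm_wfun_cmul_one_le`),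
  `‖wfun K (m f)‖_{L²} ≤ (sup (1+‖ξ‖)^K |m|) ‖f‖_{L²}` (`eLpNorm_wfun_cmul_two_le`);
* `norm_nonlin_le_convSum`, `norm_presSymbol_le_convSum` — `‖N(V, W)(ξ)‖ ≤ 4π ‖ξ‖ S(V,W)(ξ)`
  and `‖q(V,W)(ξ)‖ ≤ S(V,W)(ξ)` with the **convolution sum** `S = convSum V W = ∑_{j,k} ‖V_j ⋆ W_k‖`;
  `weight_mul_convSum_le` — pointwise `(1+‖ξ‖)^K S(m•V, W)(ξ) ≤ card² (sup w_K|m|) ‖V‖_{L²} ‖wfun K W‖_{L²}`;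
  `eLpNorm_wfun_convSum_le` — `‖wfun K S(m•V, W)‖_{L²} ≤ card² ‖wfun K m‖_{L²} ‖V‖_{L²} ‖wfun K W‖_{L²}`;
  `measurable_fconv`, `measurable_convSum` (Fubini measurability, no integrability needed);
* `nonlin_sub_left_of_memLp_pi`, `nonlin_sub_right_of_memLp_pi` (and the `vmul` forms
  `nonlin_vmul_sub_left/right`, `nonlin_vmul_self_sub_self`) — bilinearity of `N(V, W)` pointwise
  under square-integrability (the convolution integrand of two `L²` functions is integrable at
  every frequency, `integrable_fconv_integrand`; components of `L²` fields via Mathlib's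
  `MeasureTheory.MemLp.eval`).

Only the advected factor `W` is measured with weights; the advecting factor enters through
`‖V‖_{L²}` alone (the multiplier carries the weight). This asymmetry is what makes the local
existence time of the Picard scheme (`NSRegFourierPicard`) depend on `‖v‖_{L²}` only, a quantity
conserved by the energy identity, whence globality (Leray 1934, §26: "l'inégalité … devient
linéaire"; Ożański–Pooley 2018, (6.81)).

## Mathlib / tree search

Nearest neighbours in the tree (same namespace `FourierNS`, same import base; IMPORTED and reused
here): `FourierL2Convolution` — the majorant convolution `Φ ⋆ₗ Ψ` (`lconv_apply`), its Schur /
Young bounds `lconv_sq_le`, `lintegral_lconv_sq_le`, `lconv_le_sqrt_mul_sqrt`, the pointwise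
bounds `enorm_fconv_le_lconv`, `enorm_fconv_le`, the identities
`lintegral_enorm_sq_eq_eLpNorm_sq`, `lintegral_enorm_sq_rpow_half_eq_eLpNorm`,
`lintegral_sq_comp_sub_left`, and `integrable_fconv_integrand`, `memLp_comp_sub_left`;
`FourierL2Nonlin` — componentwise bilinearity `nonlin_sub_left_of_memLp`,
`nonlin_sub_right_of_memLp` (restated below in the `Pi`-`MemLp` form `…_pi` consumed by the
follow-up files). What this file ADDS on top of them: the weighted coefficient functions
`wfun K f = (1+‖ξ‖)^K • f` (valued in the same space as `f`, so that the tree's `eLpNorm` API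
applies verbatim), the weighted Young inequality `eLpNorm_wfun_fconv_le` (`L¹ × L² → L²` with the
weights moved into both factors by Peetre), the weight-absorbing multiplier bounds for
`cmul`/`vmul`, and the `convSum` majorant of the regularised nonlinearity with its weighted `L²`
bound `eLpNorm_wfun_convSum_le`. Also used: `ENNReal.lintegral_mul_le_Lp_mul_Lq`,
`eLpNorm_smul_le_mul_eLpNorm`, the tree's `FourierNS.fconv`, `FourierNS.nonlin`,
`FourierNS.lerayDerivSymbol`, Peetre `FourierNS.one_add_norm_le_mul` (`NSFourierWeights`).

## References

* J. Leray, *Sur le mouvement d'un liquide visqueux emplissant l'espace*, Acta Math. 63 (1934),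
  Ch. V §26, (5.1). [Leray1934]
* W. S. Ożański, B. C. Pooley, *Leray's fundamental work on the Navier–Stokes equations: a modern
  review*, LMS Lecture Note Ser. 452 (CUP 2018), §6.4, (6.77)–(6.81), Thm. 6.33. [OzanskiPooley2018]
* P. G. Lemarié-Rieusset, *The Navier–Stokes problem in the 21st century* (CRC 2016), §6.1
  (Fourier-side form of the bilinear term).
-/

noncomputable section

open MeasureTheory Real Set Filter Topology Function Complex
open scoped ENNReal Convolution NNReal ComplexConjugate

namespace Literature.Analysis.FluidPDE.FourierNS

/-! ### Weighted coefficient functions -/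

section Weighted

variable {E : Type*} [NormedAddCommGroup E]
variable {F : Type*} [NormedAddCommGroup F] [NormedSpace ℝ F]

/-- The weighted coefficient function `wfun K f (ξ) = (1 + ‖ξ‖)^K • f ξ`; its `L²`/`L¹` norms
are the weighted sizes `‖f‖_{L²_K}`, `‖f‖_{L¹_K}` of the Fourier-side energy method
(`‖u‖_{H^K} ≍ ‖(1+|ξ|)^K û‖_{L²}`). [folklore]
CONVENTION: for a vector field `W : E → ι → ℂ` the norms `‖wfun K W ξ‖`, `eLpNorm (wfun K W) p`
are taken in the sup norm of `ι → ℂ` (Mathlib's `Pi` norm), which differs from the Euclidean norm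
of the components by factors `≤ card ι` (`eLpNorm_wfun_apply_le` below; `NSRegFourierGlobal`
converts with `enorm_sq_le_sum` / `sum_enorm_sq_le`). [folklore] -/
def wfun (K : ℕ) (f : E → F) (ξ : E) : F := ((1 + ‖ξ‖) ^ K : ℝ) • f ξ

/-- Unfolding `wfun`. [folklore] -/
@[simp]
theorem wfun_apply (K : ℕ) (f : E → F) (ξ : E) : wfun K f ξ = ((1 + ‖ξ‖) ^ K : ℝ) • f ξ := rfl

/-- `wfun 0 f = f`. [folklore] -/
@[simp]
theorem wfun_zero (f : E → F) : wfun 0 f = f := by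
  funext ξ; simp [wfun]

/-- `‖wfun K f ξ‖ = (1 + ‖ξ‖)^K ‖f ξ‖`. [folklore] -/
theorem norm_wfun (K : ℕ) (f : E → F) (ξ : E) : ‖wfun K f ξ‖ = (1 + ‖ξ‖) ^ K * ‖f ξ‖ := by
  rw [wfun_apply, norm_smul, Real.norm_of_nonneg (by positivity)]

/-- `‖wfun K f ξ‖ₑ = ofReal ((1 + ‖ξ‖)^K) * ‖f ξ‖ₑ`. [folklore] -/
theorem enorm_wfun (K : ℕ) (f : E → F) (ξ : E) :
    ‖wfun K f ξ‖ₑ = ENNReal.ofReal ((1 + ‖ξ‖) ^ K) * ‖f ξ‖ₑ := by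
  rw [← ofReal_norm, norm_wfun, ENNReal.ofReal_mul (by positivity), ofReal_norm]

/-- `‖f ξ‖ ≤ ‖wfun K f ξ‖` (the weight is `≥ 1`). [folklore] -/
theorem norm_le_norm_wfun (K : ℕ) (f : E → F) (ξ : E) : ‖f ξ‖ ≤ ‖wfun K f ξ‖ := by
  rw [norm_wfun]
  exact le_mul_of_one_le_left (norm_nonneg _) (one_le_one_add_norm_pow ξ K)

/-- `‖f ξ‖ₑ ≤ ‖wfun K f ξ‖ₑ`. [folklore] -/
theorem enorm_le_enorm_wfun (K : ℕ) (f : E → F) (ξ : E) : ‖f ξ‖ₑ ≤ ‖wfun K f ξ‖ₑ := by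
  rw [← ofReal_norm, ← ofReal_norm]
  exact ENNReal.ofReal_le_ofReal (norm_le_norm_wfun K f ξ)

/-- Monotonicity of the weights in the exponent: `‖wfun J f ξ‖ ≤ ‖wfun K f ξ‖` for `J ≤ K`. [folklore] -/
theorem norm_wfun_mono {J K : ℕ} (h : J ≤ K) (f : E → F) (ξ : E) : ‖wfun J f ξ‖ ≤ ‖wfun K f ξ‖ := by
  rw [norm_wfun, norm_wfun]
  exact mul_le_mul_of_nonneg_right (pow_le_pow_right₀ (one_le_one_add_norm ξ) h) (norm_nonneg _)

/-- `wfun (J + K) f = wfun J (wfun K f)`. [folklore] -/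
theorem wfun_add (J K : ℕ) (f : E → F) : wfun (J + K) f = wfun J (wfun K f) := by
  funext ξ
  simp only [wfun_apply, smul_smul, pow_add]

variable [MeasurableSpace E]

/-- Measurability of `wfun K f`. [folklore] -/
theorem aestronglyMeasurable_wfun [OpensMeasurableSpace E] {μ : Measure E} (K : ℕ) {f : E → F}
    (hf : AEStronglyMeasurable f μ) : AEStronglyMeasurable (wfun K f) μ :=
  (Continuous.aestronglyMeasurable (by fun_prop)).smul hf

/-- `eLpNorm` of `wfun` is monotone in the exponent. [folklore] -/
theorem eLpNorm_wfun_mono {μ : Measure E} {J K : ℕ} (h : J ≤ K) (f : E → F) (p : ℝ≥0∞) :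
    eLpNorm (wfun J f) p μ ≤ eLpNorm (wfun K f) p μ :=
  eLpNorm_mono fun ξ => norm_wfun_mono h f ξ

/-- `eLpNorm f ≤ eLpNorm (wfun K f)`. [folklore] -/
theorem eLpNorm_le_eLpNorm_wfun {μ : Measure E} (K : ℕ) (f : E → F) (p : ℝ≥0∞) :
    eLpNorm f p μ ≤ eLpNorm (wfun K f) p μ := by
  simpa using eLpNorm_wfun_mono (Nat.zero_le K) f p (μ := μ)

end Weighted

/-! ### Pointwise and weighted-`L²` bounds for `fconv` -/

section Conv

variable {ι : Type*} [Fintype ι]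

variable {K : ℕ} {f g : (EuclideanSpace ℝ ι) → ℂ} {m : (EuclideanSpace ℝ ι) → ℝ}

omit [Fintype ι] in
/-- Peetre for the `K`-th powers, multiplicative form: `(1+‖ξ‖)^K ≤ (1+‖η‖)^K (1+‖ξ-η‖)^K`. [folklore] -/
theorem weight_le_weight_mul_weight {E : Type*} [NormedAddCommGroup E] (K : ℕ) (ξ η : E) :
    (1 + ‖ξ‖) ^ K ≤ (1 + ‖η‖) ^ K * (1 + ‖ξ - η‖) ^ K := by
  rw [← mul_pow, mul_comm]
  exact pow_le_pow_left₀ (by positivity) (one_add_norm_le_mul ξ η) K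

/-- The weight enters the convolution integrand (Peetre):
`(1+‖ξ‖)^K ‖(f ⋆ g)(ξ)‖ₑ ≤ ∫⁻ ‖wfun K f η‖ₑ ‖wfun K g (ξ - η)‖ₑ dη`. [folklore] -/
theorem weight_mul_enorm_fconv_le_lintegral_wfun (K : ℕ) (f g : (EuclideanSpace ℝ ι) → ℂ) (ξ : (EuclideanSpace ℝ ι)) :
    ENNReal.ofReal ((1 + ‖ξ‖) ^ K) * ‖fconv f g ξ‖ₑ ≤
      ∫⁻ η, ‖wfun K f η‖ₑ * ‖wfun K g (ξ - η)‖ₑ := by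
  calc ENNReal.ofReal ((1 + ‖ξ‖) ^ K) * ‖fconv f g ξ‖ₑ
      ≤ ENNReal.ofReal ((1 + ‖ξ‖) ^ K) * ∫⁻ η, ‖f η‖ₑ * ‖g (ξ - η)‖ₑ := by
        refine mul_le_mul_right ?_ _
        simpa only [lconv_apply] using enorm_fconv_le_lconv f g ξ
    _ = ∫⁻ η, ENNReal.ofReal ((1 + ‖ξ‖) ^ K) * (‖f η‖ₑ * ‖g (ξ - η)‖ₑ) := by
        rw [lintegral_const_mul' _ _ ENNReal.ofReal_ne_top]
    _ ≤ ∫⁻ η, ‖wfun K f η‖ₑ * ‖wfun K g (ξ - η)‖ₑ := by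
        refine lintegral_mono fun η => ?_
        rw [enorm_wfun, enorm_wfun]
        calc ENNReal.ofReal ((1 + ‖ξ‖) ^ K) * (‖f η‖ₑ * ‖g (ξ - η)‖ₑ)
            ≤ ENNReal.ofReal ((1 + ‖η‖) ^ K * (1 + ‖ξ - η‖) ^ K) * (‖f η‖ₑ * ‖g (ξ - η)‖ₑ) :=
              mul_le_mul_left (ENNReal.ofReal_le_ofReal (weight_le_weight_mul_weight K ξ η)) _
          _ = ENNReal.ofReal ((1 + ‖η‖) ^ K) * ‖f η‖ₑ *
                (ENNReal.ofReal ((1 + ‖ξ - η‖) ^ K) * ‖g (ξ - η)‖ₑ) := by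
              rw [ENNReal.ofReal_mul (by positivity)]; ring

/-- Measurability of `wfun K f` for measurable `f`. [folklore] -/
theorem measurable_wfun {E : Type*} [NormedAddCommGroup E] [MeasurableSpace E] [OpensMeasurableSpace E]
    {F : Type*} [NormedAddCommGroup F] [NormedSpace ℝ F] [MeasurableSpace F] [BorelSpace F]
    [SecondCountableTopology F] (K : ℕ) {f : E → F} (hf : Measurable f) : Measurable (wfun K f) :=
  ((continuous_const.add continuous_norm).pow K).measurable.smul hf

/-- **Pointwise bound of the weighted convolution by weighted `L²` norms** (Cauchy–Schwarz and
translation invariance): `(1+‖ξ‖)^K ‖(f ⋆ g)(ξ)‖ ≤ ‖wfun K f‖_{L²} ‖wfun K g‖_{L²}` at EVERY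
frequency `ξ`. In particular the convolution of two `L²` functions is bounded. [folklore] -/
theorem weight_mul_enorm_fconv_le_eLpNorm_wfun (hf : Measurable f) (hg : Measurable g) (K : ℕ)
    (ξ : EuclideanSpace ℝ ι) :
    ENNReal.ofReal ((1 + ‖ξ‖) ^ K) * ‖fconv f g ξ‖ₑ ≤
      eLpNorm (wfun K f) 2 volume * eLpNorm (wfun K g) 2 volume := by
  have ha : Measurable fun η : EuclideanSpace ℝ ι => ‖wfun K f η‖ₑ := (measurable_wfun K hf).enorm
  have hb : Measurable fun η : EuclideanSpace ℝ ι => ‖wfun K g η‖ₑ := (measurable_wfun K hg).enorm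
  calc ENNReal.ofReal ((1 + ‖ξ‖) ^ K) * ‖fconv f g ξ‖ₑ
      ≤ ((fun η => ‖wfun K f η‖ₑ) ⋆ₗ (fun η => ‖wfun K g η‖ₑ)) ξ := by
        rw [lconv_apply]; exact weight_mul_enorm_fconv_le_lintegral_wfun K f g ξ
    _ ≤ (∫⁻ η, ‖wfun K f η‖ₑ ^ 2) ^ (1 / 2 : ℝ) * (∫⁻ η, ‖wfun K g η‖ₑ ^ 2) ^ (1 / 2 : ℝ) :=
        lconv_le_sqrt_mul_sqrt ha.aemeasurable hb.aemeasurable ξ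
    _ = eLpNorm (wfun K f) 2 volume * eLpNorm (wfun K g) 2 volume := by
        rw [lintegral_enorm_sq_rpow_half_eq_eLpNorm, lintegral_enorm_sq_rpow_half_eq_eLpNorm]

/-- Unweighted form: `‖(f ⋆ g)(ξ)‖ ≤ ‖f‖_{L²} ‖g‖_{L²}` at every frequency (the `Measurable` form of the
landed `enorm_fconv_le`, kept for the follow-up files). [folklore] -/
theorem enorm_fconv_le_eLpNorm (hf : Measurable f) (hg : Measurable g) (ξ : (EuclideanSpace ℝ ι)) :
    ‖fconv f g ξ‖ₑ ≤ eLpNorm f 2 volume * eLpNorm g 2 volume :=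
  enorm_fconv_le hf.aestronglyMeasurable hg.aestronglyMeasurable ξ

/-- **Weighted Young `L¹ × L² → L²` for `fconv`**:
`‖wfun K (f ⋆ g)‖_{L²} ≤ ‖wfun K f‖_{L¹} ‖wfun K g‖_{L²}` (Peetre into the integrand, then the
landed `lintegral_lconv_sq_le` for the majorant convolution). [folklore] -/
theorem eLpNorm_wfun_fconv_le (hf : Measurable f) (hg : Measurable g) (K : ℕ) :
    eLpNorm (wfun K (fconv f g)) 2 volume ≤
      eLpNorm (wfun K f) 1 volume * eLpNorm (wfun K g) 2 volume := by
  have ha : Measurable fun η : (EuclideanSpace ℝ ι) => ‖wfun K f η‖ₑ := (measurable_wfun K hf).enorm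
  have hb : Measurable fun η : (EuclideanSpace ℝ ι) => ‖wfun K g η‖ₑ := (measurable_wfun K hg).enorm
  -- Young for the majorant convolution, with the `L²` factor in the first slot
  have hY := lintegral_lconv_sq_le hb.aemeasurable ha.aemeasurable
  have hcomm : (fun η => ‖wfun K g η‖ₑ) ⋆ₗ (fun η => ‖wfun K f η‖ₑ) =
      (fun η => ‖wfun K f η‖ₑ) ⋆ₗ (fun η => ‖wfun K g η‖ₑ) := lconvolution_comm
  rw [hcomm] at hY
  -- compare squares
  have hsq : eLpNorm (wfun K (fconv f g)) 2 volume ^ 2 ≤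
      (eLpNorm (wfun K f) 1 volume * eLpNorm (wfun K g) 2 volume) ^ 2 := by
    rw [← lintegral_enorm_sq_eq_eLpNorm_sq, mul_pow, ← lintegral_enorm_sq_eq_eLpNorm_sq,
      eLpNorm_one_eq_lintegral_enorm]
    refine le_trans (lintegral_mono fun ξ => ?_) hY
    rw [enorm_wfun]
    gcongr
    rw [lconv_apply]
    exact weight_mul_enorm_fconv_le_lintegral_wfun K f g ξ
  exact (ENNReal.pow_le_pow_left_iff two_ne_zero).1 hsq

end Conv

/-! ### The mollifier multiplier absorbs the weights -/

section Multiplier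

variable {ι : Type*} [Fintype ι]
variable {K : ℕ} {f : (EuclideanSpace ℝ ι) → ℂ} {m : (EuclideanSpace ℝ ι) → ℝ}

/-- The real multiplier as a complex-valued coefficient function. [folklore] -/
abbrev cmul (m : (EuclideanSpace ℝ ι) → ℝ) (f : (EuclideanSpace ℝ ι) → ℂ) (ξ : EuclideanSpace ℝ ι) : ℂ :=
  (m ξ : ℂ) * f ξ

omit [Fintype ι] in
/-- Measurability of `cmul m f`. [folklore] -/
theorem measurable_cmul (hm : Measurable m) (hf : Measurable f) : Measurable (cmul m f) :=
  (Complex.measurable_ofReal.comp hm).mul hf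

/-- `wfun K (cmul m f) = wfun K m • f` pointwise. [folklore] -/
theorem wfun_cmul (K : ℕ) (m : (EuclideanSpace ℝ ι) → ℝ) (f : (EuclideanSpace ℝ ι) → ℂ) :
    wfun K (cmul m f) = fun ξ => (wfun K (fun η => (m η : ℂ)) ξ) • f ξ := by
  funext ξ
  simp only [wfun_apply, cmul, smul_eq_mul, Complex.real_smul]
  ring

/-- **The multiplier carries the weight, `L¹` form** (Cauchy–Schwarz):
`‖wfun K (m f)‖_{L¹} ≤ ‖wfun K m‖_{L²} ‖f‖_{L²}`. [folklore] -/
theorem eLpNorm_wfun_cmul_one_le (hm : Measurable m) (hf : Measurable f) (K : ℕ) :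
    eLpNorm (wfun K (cmul m f)) 1 volume ≤
      eLpNorm (wfun K fun ξ => (m ξ : ℂ)) 2 volume * eLpNorm f 2 volume := by
  rw [wfun_cmul]
  have h := eLpNorm_smul_le_mul_eLpNorm (p := 2) (q := 2) (r := 1) (μ := volume) hf.aestronglyMeasurable
    (measurable_wfun K (Complex.measurable_ofReal.comp hm)).aestronglyMeasurable
  exact h

/-- **The multiplier carries the weight, `L²` form**: if `(1+‖ξ‖)^K |m ξ| ≤ M` everywhere then
`‖wfun K (m f)‖_{L²} ≤ M ‖f‖_{L²}`. [folklore] -/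
theorem eLpNorm_wfun_cmul_two_le (hm : Measurable m) (hf : Measurable f) {K : ℕ} {M : ℝ}
    (hM : ∀ ξ, (1 + ‖ξ‖) ^ K * |m ξ| ≤ M) :
    eLpNorm (wfun K (cmul m f)) 2 volume ≤ ENNReal.ofReal M * eLpNorm f 2 volume := by
  rw [wfun_cmul]
  have h := eLpNorm_smul_le_mul_eLpNorm (p := ∞) (q := 2) (r := 2) hf.aestronglyMeasurable
    (measurable_wfun K (Complex.measurable_ofReal.comp hm)).aestronglyMeasurable (μ := volume)
    (φ := wfun K fun η : EuclideanSpace ℝ ι => (m η : ℂ))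
  refine h.trans (mul_le_mul_left ?_ _)
  rw [eLpNorm_exponent_top]
  refine eLpNormEssSup_le_of_ae_enorm_bound (Eventually.of_forall fun ξ => ?_)
  rw [← ofReal_norm, norm_wfun, Complex.norm_real, Real.norm_eq_abs]
  exact ENNReal.ofReal_le_ofReal (hM ξ)

/-- `‖m f‖_{L²} ≤ ‖f‖_{L²}` when `|m| ≤ 1` (the case of a mollifier multiplier, `|𝓕⁻¹χ| ≤ ∫χ = 1`). [folklore] -/
theorem eLpNorm_cmul_le (hm : Measurable m) (hf : Measurable f) (hM : ∀ ξ, |m ξ| ≤ 1) :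
    eLpNorm (cmul m f) 2 volume ≤ eLpNorm f 2 volume := by
  have h := eLpNorm_wfun_cmul_two_le hm hf (K := 0) (M := 1) (fun ξ => by simpa using hM ξ)
  simpa using h

end Multiplier

/-! ### Bounds for the regularised nonlinearity `N(m • V, W)` -/

section Nonlin

variable {ι : Type*} [Fintype ι] [DecidableEq ι]

/-- The multiplier acting on a vector coefficient field: `(m • V)(ξ)_j = m(ξ) V(ξ)_j`
(Fourier side of the mollification `J u = χ ⋆ u`, `m = 𝓕⁻¹χ`). [folklore] -/
abbrev vmul (m : (EuclideanSpace ℝ ι) → ℝ) (V : (EuclideanSpace ℝ ι) → ι → ℂ) (ξ : EuclideanSpace ℝ ι) :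
    ι → ℂ := fun j => (m ξ : ℂ) * V ξ j

omit [Fintype ι] [DecidableEq ι] in
/-- Components of `vmul`. [folklore] -/
@[simp]
theorem vmul_apply (m : (EuclideanSpace ℝ ι) → ℝ) (V : (EuclideanSpace ℝ ι) → ι → ℂ)
    (ξ : EuclideanSpace ℝ ι) (j : ι) : vmul m V ξ j = (m ξ : ℂ) * V ξ j := rfl

omit [Fintype ι] [DecidableEq ι] in
/-- The `j`-th component of `vmul m V` is `cmul m (V · j)`. [folklore] -/
theorem vmul_comp (m : (EuclideanSpace ℝ ι) → ℝ) (V : (EuclideanSpace ℝ ι) → ι → ℂ) (j : ι) :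
    (fun ξ => vmul m V ξ j) = cmul m (V · j) := rfl

omit [Fintype ι] [DecidableEq ι] in
/-- Measurability of `vmul`. [folklore] -/
theorem measurable_vmul {m : (EuclideanSpace ℝ ι) → ℝ} {V : (EuclideanSpace ℝ ι) → ι → ℂ}
    (hm : Measurable m) (hV : Measurable V) : Measurable (vmul m V) :=
  measurable_pi_iff.2 fun j => measurable_cmul hm (measurable_pi_iff.1 hV j)

omit [DecidableEq ι] in
/-- **The convolution sum** `S(V, W)(ξ) = ∑_{j,k} ‖(V_j ⋆ W_k)(ξ)‖` controlling both the
projected nonlinearity and the pressure symbol (their multipliers are bounded by `2‖ξ‖`, `1`). [folklore] -/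
def convSum (V W : (EuclideanSpace ℝ ι) → ι → ℂ) (ξ : EuclideanSpace ℝ ι) : ℝ :=
  ∑ j, ∑ k, ‖fconv (V · j) (W · k) ξ‖

omit [DecidableEq ι] in
/-- `0 ≤ S`. [folklore] -/
theorem convSum_nonneg (V W : (EuclideanSpace ℝ ι) → ι → ℂ) (ξ : EuclideanSpace ℝ ι) :
    0 ≤ convSum V W ξ :=
  Finset.sum_nonneg fun _ _ => Finset.sum_nonneg fun _ _ => norm_nonneg _

/-- **The nonlinearity is controlled by the convolution sum**:
`‖N(V, W)(ξ)_l‖ ≤ 4π ‖ξ‖ S(V, W)(ξ)` (`|m_{jkl}(ξ)| ≤ 2‖ξ‖`). [folklore] -/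
theorem norm_nonlin_le_convSum (V W : (EuclideanSpace ℝ ι) → ι → ℂ) (ξ : EuclideanSpace ℝ ι) (l : ι) :
    ‖nonlin V W ξ l‖ ≤ 4 * π * ‖ξ‖ * convSum V W ξ := by
  rw [nonlin_apply, norm_mul, norm_neg]
  have h2π : ‖(2 * π * Complex.I : ℂ)‖ = 2 * π := by
    rw [norm_mul, norm_mul, Complex.norm_I, mul_one, Complex.norm_two, Complex.norm_real,
      Real.norm_of_nonneg Real.pi_pos.le]
  rw [h2π, convSum, Finset.mul_sum]
  have hsum : ‖∑ j, ∑ k, (lerayDerivSymbol j k l ξ : ℂ) * fconv (V · j) (W · k) ξ‖ ≤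
      ∑ j, ∑ k, 2 * ‖ξ‖ * ‖fconv (V · j) (W · k) ξ‖ := by
    refine (norm_sum_le _ _).trans (Finset.sum_le_sum fun j _ => (norm_sum_le _ _).trans
      (Finset.sum_le_sum fun k _ => ?_))
    rw [norm_mul]
    exact mul_le_mul_of_nonneg_right (norm_ofReal_lerayDerivSymbol_le j k l ξ) (norm_nonneg _)
  calc 2 * π * ‖∑ j, ∑ k, (lerayDerivSymbol j k l ξ : ℂ) * fconv (V · j) (W · k) ξ‖
      ≤ 2 * π * ∑ j, ∑ k, 2 * ‖ξ‖ * ‖fconv (V · j) (W · k) ξ‖ :=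
        mul_le_mul_of_nonneg_left hsum (by positivity)
    _ = ∑ j, 4 * π * ‖ξ‖ * ∑ k, ‖fconv (V · j) (W · k) ξ‖ := by
        rw [Finset.mul_sum]
        refine Finset.sum_congr rfl fun j _ => ?_
        rw [Finset.mul_sum, Finset.mul_sum]
        refine Finset.sum_congr rfl fun k _ => ?_
        ring

/-- The sup norm of `N(V,W)(ξ)` is controlled by the convolution sum. [folklore] -/
theorem norm_nonlin_le_convSum' (V W : (EuclideanSpace ℝ ι) → ι → ℂ) (ξ : EuclideanSpace ℝ ι) :
    ‖nonlin V W ξ‖ ≤ 4 * π * ‖ξ‖ * convSum V W ξ :=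
  (pi_norm_le_iff_of_nonneg (by have := convSum_nonneg V W ξ; positivity)).2
    fun l => norm_nonlin_le_convSum V W ξ l

omit [DecidableEq ι] in
/-- The pressure symbol is controlled by the convolution sum: `‖q(V, W)(ξ)‖ ≤ S(V, W)(ξ)`. [folklore] -/
theorem norm_presSymbol_le_convSum (V W : (EuclideanSpace ℝ ι) → ι → ℂ) (ξ : EuclideanSpace ℝ ι) :
    ‖presSymbol V W ξ‖ ≤ convSum V W ξ := by
  rw [presSymbol, norm_neg, convSum]
  refine (norm_sum_le _ _).trans (Finset.sum_le_sum fun j _ => (norm_sum_le _ _).trans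
    (Finset.sum_le_sum fun k _ => ?_))
  rw [norm_mul]
  have h1 : ‖((ξ j * ξ k / ‖ξ‖ ^ 2 : ℝ) : ℂ)‖ ≤ 1 := by
    rw [Complex.norm_real, Real.norm_eq_abs]; exact abs_mul_div_norm_sq_le_one j k ξ
  calc ‖((ξ j * ξ k / ‖ξ‖ ^ 2 : ℝ) : ℂ)‖ * ‖fconv (V · j) (W · k) ξ‖ ≤ 1 * ‖fconv (V · j) (W · k) ξ‖ :=
      mul_le_mul_of_nonneg_right h1 (norm_nonneg _)
    _ = _ := one_mul _

variable {K : ℕ} {m : (EuclideanSpace ℝ ι) → ℝ} {V W : (EuclideanSpace ℝ ι) → ι → ℂ}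

omit [DecidableEq ι] in
/-- A component is dominated by the sup norm, under `wfun` and `eLpNorm`. [folklore] -/
theorem eLpNorm_wfun_apply_le (K : ℕ) (W : (EuclideanSpace ℝ ι) → ι → ℂ) (k : ι) (p : ℝ≥0∞) :
    eLpNorm (wfun K (W · k)) p volume ≤ eLpNorm (wfun K W) p (volume : Measure (EuclideanSpace ℝ ι)) := by
  refine eLpNorm_mono fun ξ => ?_
  rw [norm_wfun, norm_wfun]
  exact mul_le_mul_of_nonneg_left (norm_le_pi_norm (W ξ) k) (by positivity)

omit [DecidableEq ι] in
/-- **Pointwise bound of the weighted convolution sum**: if `(1+‖ξ‖)^K |m| ≤ M` then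
`(1+‖ξ‖)^K S(m•V, W)(ξ) ≤ card² · M · ‖V‖_{L²} · ‖wfun K W‖_{L²}` at every `ξ`. [folklore] -/
theorem weight_mul_convSum_le (hm : Measurable m) (hV : Measurable V) (hW : Measurable W) {M : ℝ}
    (hM : ∀ ξ, (1 + ‖ξ‖) ^ K * |m ξ| ≤ M) (ξ : EuclideanSpace ℝ ι) :
    ENNReal.ofReal ((1 + ‖ξ‖) ^ K * convSum (vmul m V) W ξ) ≤
      (Fintype.card ι : ℝ≥0∞) ^ 2 * (ENNReal.ofReal M * eLpNorm V 2 volume * eLpNorm (wfun K W) 2 volume) := by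
  have hVj : ∀ j, Measurable fun ξ => V ξ j := fun j => measurable_pi_iff.1 hV j
  have hWk : ∀ k, Measurable fun ξ => W ξ k := fun k => measurable_pi_iff.1 hW k
  have hterm : ∀ j k, ENNReal.ofReal ((1 + ‖ξ‖) ^ K * ‖fconv (fun η => vmul m V η j) (W · k) ξ‖) ≤
      ENNReal.ofReal M * eLpNorm V 2 volume * eLpNorm (wfun K W) 2 volume := by
    intro j k
    rw [ENNReal.ofReal_mul (by positivity), ofReal_norm, vmul_comp]
    refine (weight_mul_enorm_fconv_le_eLpNorm_wfun (measurable_cmul hm (hVj j)) (hWk k) K ξ).trans ?_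
    refine mul_le_mul' ((eLpNorm_wfun_cmul_two_le hm (hVj j) hM).trans ?_) (eLpNorm_wfun_apply_le K W k 2)
    exact mul_le_mul_right (by simpa using eLpNorm_wfun_apply_le 0 V j 2) _
  rw [convSum, Finset.mul_sum, ENNReal.ofReal_sum_of_nonneg (fun j _ => by
    have : 0 ≤ ∑ k, ‖fconv (fun η => vmul m V η j) (W · k) ξ‖ := Finset.sum_nonneg fun _ _ => norm_nonneg _
    positivity)]
  calc ∑ j, ENNReal.ofReal ((1 + ‖ξ‖) ^ K * ∑ k, ‖fconv (fun η => vmul m V η j) (W · k) ξ‖)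
      = ∑ j, ∑ k, ENNReal.ofReal ((1 + ‖ξ‖) ^ K * ‖fconv (fun η => vmul m V η j) (W · k) ξ‖) := by
        refine Finset.sum_congr rfl fun j _ => ?_
        rw [Finset.mul_sum, ENNReal.ofReal_sum_of_nonneg (fun k _ => by positivity)]
    _ ≤ ∑ _j : ι, ∑ _k : ι, ENNReal.ofReal M * eLpNorm V 2 volume * eLpNorm (wfun K W) 2 volume :=
        Finset.sum_le_sum fun j _ => Finset.sum_le_sum fun k _ => hterm j k
    _ = (Fintype.card ι : ℝ≥0∞) ^ 2 * (ENNReal.ofReal M * eLpNorm V 2 volume * eLpNorm (wfun K W) 2 volume) := by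
        rw [Finset.sum_const, Finset.sum_const, Finset.card_univ, nsmul_eq_mul, nsmul_eq_mul]
        ring

omit [DecidableEq ι] in
/-- Measurability of `fconv f g` in the frequency, for measurable `f`, `g` (Fubini measurability
of a parametric integral; no integrability needed). [folklore] -/
theorem measurable_fconv {f g : (EuclideanSpace ℝ ι) → ℂ} (hf : Measurable f) (hg : Measurable g) :
    Measurable (fconv f g) := by
  have hF : StronglyMeasurable (uncurry fun (ξ η : EuclideanSpace ℝ ι) => f η * g (ξ - η)) :=
    ((hf.comp measurable_snd).mul (hg.comp (measurable_fst.sub measurable_snd))).stronglyMeasurable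
  have h := hF.integral_prod_right' (ν := (volume : Measure (EuclideanSpace ℝ ι)))
  have heq : (fun ξ => ∫ η, uncurry (fun (ξ η : EuclideanSpace ℝ ι) => f η * g (ξ - η)) (ξ, η)) = fconv f g := by
    funext ξ; rw [fconv_apply]; rfl
  rw [heq] at h
  exact h.measurable

omit [DecidableEq ι] in
/-- Measurability of the convolution sum in the frequency. [folklore] -/
theorem measurable_convSum (hV : Measurable V) (hW : Measurable W) : Measurable (convSum V W) := by
  refine Finset.measurable_sum _ fun j _ => Finset.measurable_sum _ fun k _ => ?_
  exact (measurable_fconv (measurable_pi_iff.1 hV j) (measurable_pi_iff.1 hW k)).norm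


omit [DecidableEq ι] in
/-- `wfun K` of the convolution sum is the double sum of the weighted norms (as functions). [folklore] -/
theorem wfun_convSum_eq_sum (K : ℕ) (V W : (EuclideanSpace ℝ ι) → ι → ℂ) :
    wfun K (convSum V W) = ∑ j, ∑ k, wfun K (fun ξ => ‖fconv (V · j) (W · k) ξ‖) := by
  funext ξ
  simp only [wfun_apply, convSum, Finset.smul_sum, Finset.sum_apply]

omit [DecidableEq ι] in
/-- The weighted `L²` norm of `ξ ↦ ‖h ξ‖` is that of `h`. [folklore] -/
theorem eLpNorm_wfun_norm_eq (K : ℕ) (h : (EuclideanSpace ℝ ι) → ℂ) (p : ℝ≥0∞) :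
    eLpNorm (wfun K fun ξ => ‖h ξ‖) p volume = eLpNorm (wfun K h) p (volume : Measure (EuclideanSpace ℝ ι)) := by
  refine eLpNorm_congr_norm_ae (Eventually.of_forall fun ξ => ?_)
  rw [norm_wfun, norm_wfun, norm_norm]

omit [DecidableEq ι] in
/-- **Weighted `L²` bound of the convolution sum** (Young `L¹ × L² → L²` termwise, the multiplier
carrying the weight of the advecting factor):
`‖wfun K S(m•V, W)‖_{L²} ≤ card² ‖wfun K m‖_{L²} ‖V‖_{L²} ‖wfun K W‖_{L²}`. [folklore] -/
theorem eLpNorm_wfun_convSum_le (hm : Measurable m) (hV : Measurable V) (hW : Measurable W) (K : ℕ) :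
    eLpNorm (wfun K (convSum (vmul m V) W)) 2 volume ≤
      (Fintype.card ι : ℝ≥0∞) ^ 2 *
        (eLpNorm (wfun K fun ξ => (m ξ : ℂ)) 2 volume * eLpNorm V 2 volume * eLpNorm (wfun K W) 2 volume) := by
  have hVj : ∀ j, Measurable fun ξ => V ξ j := fun j => measurable_pi_iff.1 hV j
  have hWk : ∀ k, Measurable fun ξ => W ξ k := fun k => measurable_pi_iff.1 hW k
  have hmV : ∀ j, Measurable fun ξ => vmul m V ξ j := fun j => measurable_cmul hm (hVj j)
  set B : ℝ≥0∞ := eLpNorm (wfun K fun ξ => (m ξ : ℂ)) 2 volume * eLpNorm V 2 volume *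
    eLpNorm (wfun K W) 2 volume with hB
  -- the summands and their measurability
  set F : ι → ι → (EuclideanSpace ℝ ι) → ℝ := fun j k =>
    wfun K (fun ξ => ‖fconv (fun η => vmul m V η j) (W · k) ξ‖) with hF
  have hFm : ∀ j k, AEStronglyMeasurable (F j k) (volume : Measure (EuclideanSpace ℝ ι)) := fun j k =>
    (measurable_wfun K (measurable_fconv (hmV j) (hWk k)).norm).aestronglyMeasurable
  have hterm : ∀ j k, eLpNorm (F j k) 2 volume ≤ B := by
    intro j k
    rw [hF, eLpNorm_wfun_norm_eq, vmul_comp]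
    refine (eLpNorm_wfun_fconv_le (measurable_cmul hm (hVj j)) (hWk k) K).trans ?_
    refine mul_le_mul' ((eLpNorm_wfun_cmul_one_le hm (hVj j) K).trans ?_) (eLpNorm_wfun_apply_le K W k 2)
    exact mul_le_mul_right (by simpa using eLpNorm_wfun_apply_le 0 V j 2) _
  rw [wfun_convSum_eq_sum]
  calc eLpNorm (∑ j, ∑ k, F j k) 2 volume
      ≤ ∑ j, eLpNorm (∑ k, F j k) 2 volume :=
        eLpNorm_sum_le (fun j _ => Finset.aestronglyMeasurable_sum _ fun k _ => hFm j k) one_le_two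
    _ ≤ ∑ j, ∑ k, eLpNorm (F j k) 2 volume :=
        Finset.sum_le_sum fun j _ => eLpNorm_sum_le (fun k _ => hFm j k) one_le_two
    _ ≤ ∑ _j : ι, ∑ _k : ι, B := Finset.sum_le_sum fun j _ => Finset.sum_le_sum fun k _ => hterm j k
    _ = (Fintype.card ι : ℝ≥0∞) ^ 2 * B := by
        rw [Finset.sum_const, Finset.sum_const, Finset.card_univ, nsmul_eq_mul, nsmul_eq_mul]
        ring

end Nonlin

/-! ### Bilinearity under square-integrability -/

section BilinearL2

variable {ι : Type*} [Fintype ι] [DecidableEq ι]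

omit [DecidableEq ι] in
/-- Square-integrability of `cmul m f` for `|m| ≤ 1`, `f ∈ L²`. [folklore] -/
theorem memLp_cmul {m : (EuclideanSpace ℝ ι) → ℝ} {f : (EuclideanSpace ℝ ι) → ℂ} (hm : Measurable m)
    (hM : ∀ ξ, |m ξ| ≤ 1) (hf : MemLp f 2 volume) : MemLp (cmul m f) 2 volume := by
  refine ⟨(Complex.measurable_ofReal.comp hm).aestronglyMeasurable.mul hf.aestronglyMeasurable, ?_⟩
  refine lt_of_le_of_lt (eLpNorm_mono fun ξ => ?_) hf.eLpNorm_lt_top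
  rw [norm_mul, Complex.norm_real, Real.norm_eq_abs]
  exact mul_le_of_le_one_left (norm_nonneg _) (hM ξ)

/-- Bilinearity of `N` in the first slot, `Pi`-`MemLp` form of the landed
`nonlin_sub_left_of_memLp` (`FourierL2Nonlin`). [folklore] -/
theorem nonlin_sub_left_of_memLp_pi {V₁ V₂ W : (EuclideanSpace ℝ ι) → ι → ℂ} (h₁ : MemLp V₁ 2 volume)
    (h₂ : MemLp V₂ 2 volume) (hW : MemLp W 2 volume) (ξ : EuclideanSpace ℝ ι) :
    nonlin (V₁ - V₂) W ξ = nonlin V₁ W ξ - nonlin V₂ W ξ :=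
  nonlin_sub_left_of_memLp (fun j => h₁.eval j) (fun j => h₂.eval j) (fun k => hW.eval k) ξ

/-- Bilinearity of `N` in the second slot, `Pi`-`MemLp` form of the landed
`nonlin_sub_right_of_memLp` (`FourierL2Nonlin`). [folklore] -/
theorem nonlin_sub_right_of_memLp_pi {V W₁ W₂ : (EuclideanSpace ℝ ι) → ι → ℂ} (hV : MemLp V 2 volume)
    (h₁ : MemLp W₁ 2 volume) (h₂ : MemLp W₂ 2 volume) (ξ : EuclideanSpace ℝ ι) :
    nonlin V (W₁ - W₂) ξ = nonlin V W₁ ξ - nonlin V W₂ ξ :=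
  nonlin_sub_right_of_memLp (fun j => hV.eval j) (fun k => h₁.eval k) (fun k => h₂.eval k) ξ

omit [DecidableEq ι] in
/-- Square-integrability of `vmul m V` for `|m| ≤ 1`, `V ∈ L²`. [folklore] -/
theorem memLp_vmul {m : (EuclideanSpace ℝ ι) → ℝ} {V : (EuclideanSpace ℝ ι) → ι → ℂ} (hm : Measurable m)
    (hM : ∀ ξ, |m ξ| ≤ 1) (hV : MemLp V 2 volume) : MemLp (vmul m V) 2 volume := by
  have hmeas : AEStronglyMeasurable (vmul m V) volume := by
    have h1 : AEStronglyMeasurable (fun ξ => ((m ξ : ℂ))) volume :=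
      (Complex.measurable_ofReal.comp hm).aestronglyMeasurable
    have : vmul m V = fun ξ => (m ξ : ℂ) • V ξ := by
      funext ξ; ext j; simp [vmul]
    rw [this]
    exact h1.smul hV.aestronglyMeasurable
  refine ⟨hmeas, lt_of_le_of_lt (eLpNorm_mono fun ξ => ?_) hV.eLpNorm_lt_top⟩
  refine (pi_norm_le_iff_of_nonneg (norm_nonneg _)).2 fun j => ?_
  rw [vmul_apply, norm_mul, Complex.norm_real, Real.norm_eq_abs]
  exact (mul_le_of_le_one_left (norm_nonneg _) (hM ξ)).trans (norm_le_pi_norm (V ξ) j)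

omit [Fintype ι] [DecidableEq ι] in
/-- `vmul` is additive in the field: `m • (V₁ - V₂) = m • V₁ - m • V₂`. [folklore] -/
theorem vmul_sub (m : (EuclideanSpace ℝ ι) → ℝ) (V₁ V₂ : (EuclideanSpace ℝ ι) → ι → ℂ) :
    vmul m (V₁ - V₂) = vmul m V₁ - vmul m V₂ := by
  funext ξ; ext j; simp [vmul, mul_sub]

/-- **Bilinearity of the regularised nonlinearity in the advecting slot** under
square-integrability: `N(m•(V₁ - V₂), W) = N(m•V₁, W) - N(m•V₂, W)` pointwise. [folklore] -/
theorem nonlin_vmul_sub_left {m : (EuclideanSpace ℝ ι) → ℝ} {V₁ V₂ W : (EuclideanSpace ℝ ι) → ι → ℂ}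
    (hm : Measurable m) (hM : ∀ ξ, |m ξ| ≤ 1) (h₁ : MemLp V₁ 2 volume) (h₂ : MemLp V₂ 2 volume)
    (hW : MemLp W 2 volume) (ξ : EuclideanSpace ℝ ι) :
    nonlin (vmul m (V₁ - V₂)) W ξ = nonlin (vmul m V₁) W ξ - nonlin (vmul m V₂) W ξ := by
  rw [vmul_sub]
  exact nonlin_sub_left_of_memLp_pi (memLp_vmul hm hM h₁) (memLp_vmul hm hM h₂) hW ξ

/-- **Bilinearity in the advected slot**: `N(m•V, W₁ - W₂) = N(m•V, W₁) - N(m•V, W₂)` pointwise. [folklore] -/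
theorem nonlin_vmul_sub_right {m : (EuclideanSpace ℝ ι) → ℝ} {V W₁ W₂ : (EuclideanSpace ℝ ι) → ι → ℂ}
    (hm : Measurable m) (hM : ∀ ξ, |m ξ| ≤ 1) (hV : MemLp V 2 volume) (h₁ : MemLp W₁ 2 volume)
    (h₂ : MemLp W₂ 2 volume) (ξ : EuclideanSpace ℝ ι) :
    nonlin (vmul m V) (W₁ - W₂) ξ = nonlin (vmul m V) W₁ ξ - nonlin (vmul m V) W₂ ξ :=
  nonlin_sub_right_of_memLp_pi (memLp_vmul hm hM hV) h₁ h₂ ξ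

/-- `N(m•V, V) - N(m•W, W) = N(m•(V - W), V) + N(m•W, V - W)`. [folklore] -/
theorem nonlin_vmul_self_sub_self {m : (EuclideanSpace ℝ ι) → ℝ} {V W : (EuclideanSpace ℝ ι) → ι → ℂ}
    (hm : Measurable m) (hM : ∀ ξ, |m ξ| ≤ 1) (hV : MemLp V 2 volume) (hW : MemLp W 2 volume)
    (ξ : EuclideanSpace ℝ ι) :
    nonlin (vmul m V) V ξ - nonlin (vmul m W) W ξ =
      nonlin (vmul m (V - W)) V ξ + nonlin (vmul m W) (V - W) ξ := by
  rw [nonlin_vmul_sub_left hm hM hV hW hV, nonlin_vmul_sub_right hm hM hW hV hW]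
  abel

end BilinearL2

end Literature.Analysis.FluidPDE.FourierNS

end
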